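import Mathlib
import Summits.CriticalPhenomena.SAWScalingLimit.Theorems.SAWDefectDecoherenceDefectDecoherenceTmStrata
import Summits.CriticalPhenomena.SAWScalingLimit.Theorems.SAWDefectDecoherenceDefectDecoherenceTmOrbit
import Summits.CriticalPhenomena.SAWScalingLimit.Theorems.SAWDefectDecoherenceDefectDecoherenceScaleInduction
import HarnessLib

/-!
# The macroscopic recursion: stubs `stub_telescopingRecursionMacro` (S3') and
`stub_scaleInductionMacro` (S4') of the reshaped line `tip-martingale-depth-induction`
(crux `SAWDefectDecoherence.DefectDecoherence`, stmt-CriticalPhenomena-8549; vocabulary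
`…/Theorems/SAWDefectDecoherenceTipMartingaleDefs.lean`)

RESHAPE of the line after wave 1 (drefute: the registered orbit-mixing stub S1, `MixingBound φ`
for ALL ratios `R/s` and ALL scales `s ≥ 2`, is over-stated; the composition only consumes ratios
`≤ 2^J` and scales `≥ smin`).  Contents: the restricted predicates `MixingBoundOn φ m₀ smin`,
`RecursionStepOn D φ c β B₀ J smin` (+ comparison lemmas `MixingBound.on`, `RecursionStep.on`);
**S3'** `stub_telescopingRecursionMacro` = the landed S3 proof (`…TelescopingRecursion.lean`)
re-run at `R = s₀2^J` (mixing at ratios `2^{J-i} ≤ 2^J`, scales `s₀2^i ≥ s₀ ≥ smin(2^J)`);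
**S4'** `stub_scaleInductionMacro` = the landed S4 proof (`…ScaleInduction.lean`; helpers
`tm_exists_doublings`, `tm_strataSum_le`, `tm_etaNew_le` reused) started at a dyadic block `n₀`
with `2^{n₀} ≥ smin(J)/2`, base constant `A = B₀ (2^{n₀} 2^{J+1})^θ`.
Sources: the line card `Lines/tip-martingale-depth-induction.md`; drefute note
`Cruxes/DefectDecoherence/DrefuteStubOrbitMixing.md` (refuter-drefute-stmt-CriticalPhenomena-8549-0).
Deliberately NOT here: the two open stubs of the reshaped line (macroscopic orbit mixing S1',
wall exit S2) and the composition.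
-/

noncomputable section

open scoped BigOperators ComplexConjugate Classical
open Literature.Probability.LatticeModels Literature.Probability.RandomPlanarGeometry.SAW

namespace Summit.CriticalPhenomena.SAWScalingLimit.Theorems.DefectDecoherence.TipMartingale

/-! ### Restricted predicates -/

/-- Mixing bound restricted to ratios `R/s ≤ m₀` and picture scales `s ≥ smin`. [folklore] -/
def MixingBoundOn (φ : ℝ → ℝ) (m₀ smin : ℝ) : Prop :=
  ∀ (Λ : Finset HexVertex) (u w v : HexVertex) (R : ℝ), Admissible Λ u w v R →
    ∀ r s : ℝ, 1 ≤ r → r + 1 ≤ s → smin ≤ s → s ≤ R → R ≤ m₀ * s →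
      prefixSumR Λ u w v r (fun y z γ =>
          contraction Λ u w v r s (pic v s y z γ) *
            (xc ^ γ.length * mass (picDom Λ v s (pic v s y z γ)) y z v))
        ≤ φ (R / s) * prefixSumR Λ u w v r (fun y z γ =>
            xc ^ γ.length * mass (picDom Λ v s (pic v s y z γ)) y z v)

/-- Recursion step restricted to `R = s₀ 2^J` (bounded ratios) and `s₀ ≥ smin` (large scales). [folklore] -/
def RecursionStepOn (D : ℝ → ℝ → Prop) (φ : ℝ → ℝ) (c β B₀ : ℝ) (J : ℕ) (smin : ℝ) : Prop :=
  ∀ η : ℝ → ℝ, (∀ ρ, 0 ≤ η ρ) → (∀ ρ, 1 ≤ ρ → D ρ (η ρ)) →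
    ∀ (r s₀ : ℝ) (N : ℕ), 1 ≤ r / 2 ^ N → r / 2 ^ N < 2 → r + 1 ≤ s₀ → smin ≤ s₀ →
      D (s₀ * 2 ^ J) (etaNew φ c β B₀ η (s₀ * 2 ^ J) r s₀ J N)

/-- The full mixing bound implies every restricted one. [folklore] -/
theorem MixingBound.on {φ : ℝ → ℝ} (h : MixingBound φ) (m₀ smin : ℝ) :
    MixingBoundOn φ m₀ smin :=
  fun Λ u w v R hadm r s hr hrs _ hsR _ => h Λ u w v R hadm r s hr hrs hsR

/-- The full recursion step implies every restricted one. [folklore] -/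
theorem RecursionStep.on {D : ℝ → ℝ → Prop} {φ : ℝ → ℝ} {c β B₀ : ℝ}
    (h : RecursionStep D φ c β B₀) (J : ℕ) (smin : ℝ) : RecursionStepOn D φ c β B₀ J smin :=
  fun η hη hD r s₀ N h1 h2 h3 _ => h η hη hD (s₀ * 2 ^ J) r s₀ J N h1 h2 h3 le_rfl

/-! ### S3' — the telescoped recursion from macroscopic mixing -/

section Assembly

variable {Λ : Finset HexVertex} {u w v : HexVertex} {r : ℝ}

/-- `strataSum` is nonnegative. [folklore] -/
private theorem strataSum_nonneg' {c β B₀ r : ℝ} {N : ℕ} {η : ℝ → ℝ} {C : ℝ} (hc : 0 ≤ c)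
    (hB₀ : 0 ≤ B₀) (hη : ∀ ρ, 0 ≤ η ρ) (hC : 0 ≤ C) : 0 ≤ strataSum c β B₀ r N η C := by
  have hpow : ∀ j : ℕ, 0 ≤ (C * 2 ^ j) ^ (-β) := fun j =>
    Real.rpow_nonneg (mul_nonneg hC (pow_nonneg zero_le_two _)) _
  exact mul_nonneg hc (add_nonneg (Finset.sum_nonneg fun j _ => mul_nonneg (hpow j) (hη _))
    (mul_nonneg (hpow N) hB₀))

/-- The exit predicate is `rot3 v`-invariant. [folklore] -/
private theorem map_rot3_mem_Ex' (L : ℝ) (l : List HexVertex) :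
    l.map (rot3 v) ∈ Ex v L ↔ l ∈ Ex v L := by
  simp only [mem_Ex, List.mem_map]
  constructor
  · rintro ⟨_, ⟨q, hq, rfl⟩, h⟩
    rw [dist_rot3] at h
    exact ⟨q, hq, h⟩
  · rintro ⟨q, hq, h⟩
    exact ⟨rot3 v q, ⟨q, hq, rfl⟩, by rw [dist_rot3]; exact h⟩

/-- `ℤ/3` covariance of the restricted defect of picture domains. [folklore] -/
private theorem TC_picDom_rotPic' {R s : ℝ} (hdeep : Deep Λ v R) (hs : s ≤ R)
    {E : List HexVertex → Prop} (hE : ∀ l : List HexVertex, E (l.map (rot3 v)) ↔ E l)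
    (P : Picture) :
    TC (picDom Λ v s (rotPic v P)) s((rotPic v P).2.1, (rotPic v P).2.2) v E =
      (starRingEnd ℂ) (triZeta ^ 2) * TC (picDom Λ v s P) s(P.2.1, P.2.2) v E := by
  rw [picDom_rotPic hdeep hs, show s((rotPic v P).2.1, (rotPic v P).2.2) =
    (s(P.2.1, P.2.2)).map (rot3 v) by simp [rotPic]]
  exact TC_rot3 v hE _ _

/-- **S3' — THE TELESCOPED ONE-STEP RECURSION FROM MACROSCOPIC MIXING** (stub
`stub_telescopingRecursionMacro` of the reshaped line): for the ratio cap `m₀ = 2^J` take the scale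
floor `smin(2^J)` of the mixing hypothesis; at depth `R = s₀2^J` the landed S3 argument uses mixing
only at ratios `R/(s₀2^i) = 2^{J-i} ≤ 2^J` and scales `s₀2^i ≥ s₀ ≥ smin`. [folklore] -/
theorem stub_telescopingRecursionMacro :
    ∀ (φ : ℝ → ℝ) (c β B₀ : ℝ), (∀ m, 1 ≤ m → 0 ≤ φ m) → 0 ≤ c → 0 < β → 0 ≤ B₀ →
      CrudeBound B₀ → (∀ m₀ : ℝ, 1 ≤ m₀ → ∃ smin : ℝ, MixingBoundOn φ m₀ smin) → ExitBound c β →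
        ∀ J : ℕ, ∃ smin : ℝ, RecursionStepOn DepthBound φ c β B₀ J smin := by
  intro φ c β B₀ hφ hc _hβ hB₀ hB hMixOn hE J
  -- the mixing bound at the ratio cap `m₀ = 2^J`, valid for picture scales `s ≥ smin`
  obtain ⟨smin, hMix⟩ := hMixOn (2 ^ J) (one_le_pow₀ one_le_two)
  refine ⟨smin, ?_⟩
  intro η hη hD r s₀ N hN1 _hN2 hs₀ hsmin Λ u w v hA
  set R : ℝ := s₀ * 2 ^ J with hR_def
  have hJ : s₀ * 2 ^ J ≤ R := le_rfl
  have h2N : (0 : ℝ) < 2 ^ N := pow_pos two_pos N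
  have hr1 : 1 ≤ r := by
    have h1 := (le_div_iff₀ h2N).1 hN1
    have h2 : (1 : ℝ) ≤ 2 ^ N := one_le_pow₀ one_le_two
    linarith
  have hr0 : 0 < r := by linarith
  have hsc_ge : ∀ i : ℕ, r + 1 ≤ s₀ * 2 ^ i := fun i =>
    hs₀.trans (le_mul_of_one_le_right (by linarith) (one_le_pow₀ one_le_two))
  have hsc_le : ∀ i : ℕ, i ≤ J → s₀ * 2 ^ i ≤ R := fun i hi =>
    le_trans (mul_le_mul_of_nonneg_left (pow_le_pow_right₀ one_le_two hi) (by linarith)) hJ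
  have hsc_pos : ∀ i : ℕ, 0 < s₀ * 2 ^ i := fun i => by linarith [hsc_ge i]
  have hs₀1 : r ≤ s₀ := by linarith
  have hs₀R : s₀ ≤ R := by simpa using hsc_le 0 (Nat.zero_le J)
  have hrR : r ≤ R := hs₀1.trans hs₀R
  have hφi : ∀ i : ℕ, i ≤ J → 0 ≤ φ (R / (s₀ * 2 ^ i)) := fun i hi =>
    hφ _ ((one_le_div (hsc_pos i)).2 (hsc_le i hi))
  have hSS : ∀ i : ℕ, 0 ≤ strataSum c β B₀ r N η (s₀ * 2 ^ i / r) := fun i =>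
    strataSum_nonneg' hc hB₀ hη (div_nonneg (hsc_pos i).le hr0.le)
  have hCi : ∀ i : ℕ, 1 ≤ s₀ * 2 ^ i / r := fun i => (one_le_div hr0).2 (by linarith [hsc_ge i])
  have hCr : ∀ i : ℕ, s₀ * 2 ^ i / r * r = s₀ * 2 ^ i := fun i => div_mul_cancel₀ _ hr0.ne'
  obtain ⟨-, hadj, hu, -, -, hdeep⟩ := (admissible_iff _ _ _ _ _).1 hA
  have hwr : r < dist (hexCenter w) (hexCenter v) := by
    have hu' : R < dist (hexCenter u) (hexCenter v) := lt_of_not_ge fun h => hu (hdeep u h)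
    have h3 := dist_triangle (hexCenter u) (hexCenter w) (hexCenter v)
    have h4 := dist_hexCenter_le_one_of_adj hadj
    linarith
  have hM := mass_nonneg Λ u w v
  have hMren := tm_mass_renewal Λ u w v r hu hr1 hwr
  have hpdM : ∀ (s : ℝ) (y z : HexVertex) (π : HexMidEdgeSAW Λ s(u, w) s(y, z)),
      mass (picDom Λ v s (pic v s y z π)) y z v ≤ mass (Λ \ π.verts.toFinset) y z v := by
    intro s y z π
    rw [mass_eq_TR, mass_eq_TR]
    exact TR_le_of_subset (picDom_subset π) _ _ _
  have hT : defect Λ u w v =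
      prefixSumC Λ u w v r (fun y z π => π.weight xc (5 / 8) *
        defect (picDom Λ v s₀ (pic v s₀ y z π)) y z v) +
      (∑ i ∈ Finset.range J, prefixSumC Λ u w v r (fun y z π => π.weight xc (5 / 8) *
        TC (picDom Λ v (s₀ * 2 ^ (i + 1)) (pic v (s₀ * 2 ^ (i + 1)) y z π)) s(y, z) v
          (· ∈ Ex v (s₀ * 2 ^ i)))) +
      prefixSumC Λ u w v r (fun y z π => π.weight xc (5 / 8) *
        TC (Λ \ π.verts.toFinset) s(y, z) v (· ∈ Ex v (s₀ * 2 ^ J))) := by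
    rw [tm_defect_renewal Λ u w v r hu hr1 hwr, ← prefixSumC_sum, ← prefixSumC_add,
      ← prefixSumC_add]
    refine prefixSumC_congr fun y z π hP => ?_
    rw [defect_telescope hA hr1 hP hs₀1 J hJ, mul_add, mul_add, Finset.mul_sum]
  have hB0 : ‖prefixSumC Λ u w v r (fun y z π => π.weight xc (5 / 8) *
      defect (picDom Λ v s₀ (pic v s₀ y z π)) y z v)‖ ≤ φ (R / s₀) * η r * mass Λ u w v := by
    have cov : ∀ P : Picture, defect (picDom Λ v s₀ (rotPic v P)) (rotPic v P).2.1
        (rotPic v P).2.2 v = (starRingEnd ℂ) (triZeta ^ 2) *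
          defect (picDom Λ v s₀ P) P.2.1 P.2.2 v := fun P => by
      rw [defect_eq_TC, defect_eq_TC]
      exact TC_picDom_rotPic' hdeep hs₀R (fun _ => Iff.rfl) P
    calc _ ≤ _ := orbit_bound v r s₀ (fun P => defect (picDom Λ v s₀ P) P.2.1 P.2.2 v) cov
      _ ≤ prefixSumR Λ u w v r (fun y z π => η r * (contraction Λ u w v r s₀ (pic v s₀ y z π) *
          (xc ^ π.length * mass (picDom Λ v s₀ (pic v s₀ y z π)) y z v))) := by
        refine prefixSumR_mono fun y z π hP => ?_
        have h1 : ‖defect (picDom Λ v s₀ (pic v s₀ y z π)) y z v‖ ≤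
            η r * mass (picDom Λ v s₀ (pic v s₀ y z π)) y z v :=
          hD r hr1 _ _ _ _ (admissible_picDom hA hr1 hs₀1 hs₀R hP)
        have h2 : 0 ≤ contraction Λ u w v r s₀ (pic v s₀ y z π) :=
          div_nonneg (norm_nonneg _) (Finset.sum_nonneg fun k _ => picMass_nonneg v r s₀ _)
        calc _ ≤ contraction Λ u w v r s₀ (pic v s₀ y z π) * (xc ^ π.length *
              (η r * mass (picDom Λ v s₀ (pic v s₀ y z π)) y z v)) :=
              mul_le_mul_of_nonneg_left (mul_le_mul_of_nonneg_left h1 (pow_nonneg xc_pos.le _))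
                h2
          _ = _ := by ring
      _ = η r * prefixSumR Λ u w v r (fun y z π => contraction Λ u w v r s₀ (pic v s₀ y z π) *
          (xc ^ π.length * mass (picDom Λ v s₀ (pic v s₀ y z π)) y z v)) :=
        prefixSumR_mul_left _ _
      _ ≤ η r * (φ (R / s₀) * prefixSumR Λ u w v r (fun y z π =>
          xc ^ π.length * mass (picDom Λ v s₀ (pic v s₀ y z π)) y z v)) :=
        mul_le_mul_of_nonneg_left (hMix Λ u w v R hA r s₀ hr1 hs₀ hsmin hs₀R
          (by rw [hR_def, mul_comm])) (hη r)
      _ ≤ η r * (φ (R / s₀) * prefixSumR Λ u w v r (fun y z π =>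
          xc ^ π.length * mass (Λ \ π.verts.toFinset) y z v)) := by
        refine mul_le_mul_of_nonneg_left (mul_le_mul_of_nonneg_left (prefixSumR_mono
          fun y z π _ => mul_le_mul_of_nonneg_left (hpdM s₀ y z π) (pow_nonneg xc_pos.le _)) ?_)
          (hη r)
        simpa using hφi 0 (Nat.zero_le J)
      _ = φ (R / s₀) * η r * mass Λ u w v := by rw [← hMren]; ring
  have hBi : ∀ i ∈ Finset.range J, ‖prefixSumC Λ u w v r (fun y z π => π.weight xc (5 / 8) *
      TC (picDom Λ v (s₀ * 2 ^ (i + 1)) (pic v (s₀ * 2 ^ (i + 1)) y z π)) s(y, z) v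
        (· ∈ Ex v (s₀ * 2 ^ i)))‖ ≤
      φ (R / (s₀ * 2 ^ (i + 1))) * strataSum c β B₀ r N η (s₀ * 2 ^ i / r) * mass Λ u w v := by
    intro i hi
    have hi' : i + 1 ≤ J := Finset.mem_range.1 hi
    have hsi1 : r ≤ s₀ * 2 ^ (i + 1) := by linarith [hsc_ge (i + 1)]
    have cov : ∀ P : Picture, TC (picDom Λ v (s₀ * 2 ^ (i + 1)) (rotPic v P))
        s((rotPic v P).2.1, (rotPic v P).2.2) v (· ∈ Ex v (s₀ * 2 ^ i)) =
          (starRingEnd ℂ) (triZeta ^ 2) * TC (picDom Λ v (s₀ * 2 ^ (i + 1)) P)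
            s(P.2.1, P.2.2) v (· ∈ Ex v (s₀ * 2 ^ i)) := fun P =>
      TC_picDom_rotPic' hdeep (hsc_le _ hi') (map_rot3_mem_Ex' _) P
    calc _ ≤ _ := orbit_bound v r (s₀ * 2 ^ (i + 1)) (fun P =>
          TC (picDom Λ v (s₀ * 2 ^ (i + 1)) P) s(P.2.1, P.2.2) v (· ∈ Ex v (s₀ * 2 ^ i))) cov
      _ ≤ prefixSumR Λ u w v r (fun y z π => strataSum c β B₀ r N η (s₀ * 2 ^ i / r) *
          (contraction Λ u w v r (s₀ * 2 ^ (i + 1)) (pic v (s₀ * 2 ^ (i + 1)) y z π) *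
          (xc ^ π.length * mass (picDom Λ v (s₀ * 2 ^ (i + 1))
            (pic v (s₀ * 2 ^ (i + 1)) y z π)) y z v))) := by
        refine prefixSumR_mono fun y z π hP => ?_
        have h1 : ‖TC (picDom Λ v (s₀ * 2 ^ (i + 1)) (pic v (s₀ * 2 ^ (i + 1)) y z π)) s(y, z) v
            (· ∈ Ex v (s₀ * 2 ^ i))‖ ≤ strataSum c β B₀ r N η (s₀ * 2 ^ i / r) *
              mass (picDom Λ v (s₀ * 2 ^ (i + 1)) (pic v (s₀ * 2 ^ (i + 1)) y z π)) y z v :=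
          strata_bound hc hη hD hB hE hN1 (hCi i)
            (admissible_picDom hA hr1 hsi1 (hsc_le _ hi') hP) ((isPrefix_iff π).1 hP).2.2.1
            (hCr i)
        have h2 : 0 ≤ contraction Λ u w v r (s₀ * 2 ^ (i + 1)) (pic v (s₀ * 2 ^ (i + 1)) y z π) :=
          div_nonneg (norm_nonneg _) (Finset.sum_nonneg fun k _ => picMass_nonneg v r _ _)
        calc _ ≤ contraction Λ u w v r (s₀ * 2 ^ (i + 1)) (pic v (s₀ * 2 ^ (i + 1)) y z π) *
              (xc ^ π.length * (strataSum c β B₀ r N η (s₀ * 2 ^ i / r) *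
                mass (picDom Λ v (s₀ * 2 ^ (i + 1)) (pic v (s₀ * 2 ^ (i + 1)) y z π)) y z v)) :=
              mul_le_mul_of_nonneg_left (mul_le_mul_of_nonneg_left h1 (pow_nonneg xc_pos.le _))
                h2
          _ = _ := by ring
      _ = strataSum c β B₀ r N η (s₀ * 2 ^ i / r) * prefixSumR Λ u w v r (fun y z π =>
          contraction Λ u w v r (s₀ * 2 ^ (i + 1)) (pic v (s₀ * 2 ^ (i + 1)) y z π) *
          (xc ^ π.length * mass (picDom Λ v (s₀ * 2 ^ (i + 1))
            (pic v (s₀ * 2 ^ (i + 1)) y z π)) y z v)) := prefixSumR_mul_left _ _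
      _ ≤ strataSum c β B₀ r N η (s₀ * 2 ^ i / r) * (φ (R / (s₀ * 2 ^ (i + 1))) *
          prefixSumR Λ u w v r (fun y z π => xc ^ π.length *
            mass (picDom Λ v (s₀ * 2 ^ (i + 1)) (pic v (s₀ * 2 ^ (i + 1)) y z π)) y z v)) :=
        mul_le_mul_of_nonneg_left (hMix Λ u w v R hA r (s₀ * 2 ^ (i + 1)) hr1 (hsc_ge _)
          (hsmin.trans (le_mul_of_one_le_right (by linarith) (one_le_pow₀ one_le_two)))
          (hsc_le _ hi') (by
            rw [hR_def, mul_comm ((2:ℝ) ^ J), mul_assoc]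
            exact mul_le_mul_of_nonneg_left
              (le_mul_of_one_le_left (pow_nonneg zero_le_two _) (one_le_pow₀ one_le_two))
              (by linarith))) (hSS i)
      _ ≤ strataSum c β B₀ r N η (s₀ * 2 ^ i / r) * (φ (R / (s₀ * 2 ^ (i + 1))) *
          prefixSumR Λ u w v r (fun y z π => xc ^ π.length *
            mass (Λ \ π.verts.toFinset) y z v)) :=
        mul_le_mul_of_nonneg_left (mul_le_mul_of_nonneg_left (prefixSumR_mono
          fun y z π _ => mul_le_mul_of_nonneg_left (hpdM _ y z π) (pow_nonneg xc_pos.le _))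
            (hφi _ hi')) (hSS i)
      _ = _ := by rw [← hMren]; ring
  have hBX : ‖prefixSumC Λ u w v r (fun y z π => π.weight xc (5 / 8) *
      TC (Λ \ π.verts.toFinset) s(y, z) v (· ∈ Ex v (s₀ * 2 ^ J)))‖ ≤
      strataSum c β B₀ r N η (s₀ * 2 ^ J / r) * mass Λ u w v := by
    calc _ ≤ prefixSumR Λ u w v r (fun y z π => xc ^ π.length *
          (strataSum c β B₀ r N η (s₀ * 2 ^ J / r) * mass (Λ \ π.verts.toFinset) y z v)) :=
          norm_prefixSumC_le _ _ fun y z π hP => strata_bound hc hη hD hB hE hN1 (hCi J)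
            (admissible_sdiff hA hr1 hrR hP) ((isPrefix_iff π).1 hP).2.2.1 (hCr J)
      _ = strataSum c β B₀ r N η (s₀ * 2 ^ J / r) * prefixSumR Λ u w v r (fun y z π =>
          xc ^ π.length * mass (Λ \ π.verts.toFinset) y z v) := by
          rw [← prefixSumR_mul_left]
          congr 1; funext y z π; ring
      _ = _ := by rw [← hMren]
  rw [hT]
  refine ((norm_add_le _ _).trans (add_le_add ((norm_add_le _ _).trans (add_le_add hB0
    ((norm_sum_le _ _).trans (Finset.sum_le_sum hBi)))) hBX)).trans (le_of_eq ?_)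
  rw [etaNew, add_mul, add_mul, Finset.sum_mul]


end Assembly

/-! ### S4' — the dyadic induction started at a high block -/

/-- **S4' — SCALE INDUCTION FROM THE RESTRICTED RECURSION** (stub `stub_scaleInductionMacro` of
the reshaped line): as the landed S4, with the first inductive block `n₀` chosen so that
`2^{n₀} ≥ smin(J)/2` (then `s₀ = 2r ≥ smin` in every inductive step) and base constant
`A = B₀ (2^{n₀}2^{J+1})^θ`. [folklore] -/
theorem stub_scaleInductionMacro :
    ∀ (D : ℝ → ℝ → Prop) (cα α c β B₀ : ℝ),
      (∀ R b b', b ≤ b' → D R b → D R b') → 3 / 4 < α → 3 / 4 < β → 0 ≤ cα → 0 ≤ c → 0 ≤ B₀ →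
      (∀ ρ, 1 ≤ ρ → D ρ B₀) →
      (∀ J : ℕ, ∃ smin : ℝ, RecursionStepOn D (fun m => cα * m ^ (-α)) c β B₀ J smin) →
      ∃ C θ : ℝ, 3 / 4 < θ ∧ ∀ R, 1 ≤ R → D R (C * R ^ (-θ)) := by
  intro D cα α c β B₀ hmono hα hβ hcα hc hB₀ hbase hstepOn
  -- exponents `3/4 < θ < m = min α β`
  obtain ⟨m, hmα, hmβ, hm34⟩ : ∃ m : ℝ, m ≤ α ∧ m ≤ β ∧ 3 / 4 < m :=
    ⟨min α β, min_le_left _ _, min_le_right _ _, lt_min hα hβ⟩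
  obtain ⟨θ, hθ34, hθm⟩ : ∃ θ : ℝ, 3 / 4 < θ ∧ θ < m := ⟨(3 / 4 + m) / 2, by linarith, by linarith⟩
  have hθ0 : 0 < θ := by linarith
  have hm0 : 0 ≤ m := by linarith
  -- constants: strata constant `K₂`, number of doublings `J`, `K₀ = 2^{J+1}`, `A = B₀ K₀^θ`
  obtain ⟨K₂, hK₂, hstrata⟩ := tm_strataSum_le hθ0 (hθm.trans_le hmβ)
  obtain ⟨J, hJ⟩ := tm_exists_doublings (cα + c * K₂) (cα * c * K₂) m θ hθm
  -- the restricted recursion step at this `J`, valid for first picture scales `s₀ ≥ smin`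
  obtain ⟨smin, hstep⟩ := hstepOn J
  unfold RecursionStepOn at hstep
  -- first inductive block `n₀`: `2 ^ n₀ ≥ smin / 2`, so that `s₀ = 2r ≥ smin` there
  obtain ⟨n₀, hn₀⟩ : ∃ n₀ : ℕ, smin / 2 < 2 ^ n₀ := pow_unbounded_of_one_lt _ (by norm_num)
  obtain ⟨K₀, hK₀_def⟩ : ∃ K₀ : ℝ, K₀ = 2 ^ (J + 1) := ⟨_, rfl⟩
  have hK₀1 : (1:ℝ) ≤ K₀ := hK₀_def ▸ one_le_pow₀ (by norm_num)
  have hK₀2 : (2:ℝ) ≤ K₀ := by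
    rw [hK₀_def, pow_succ]
    exact le_mul_of_one_le_left (by norm_num) (one_le_pow₀ (by norm_num))
  have hK₀pos : (0:ℝ) < K₀ := by linarith
  have hK₀' : (1:ℝ) ≤ 2 ^ n₀ * K₀ := one_le_mul_of_one_le_of_one_le (one_le_pow₀ (by norm_num)) hK₀1
  obtain ⟨A, hA_def⟩ : ∃ A : ℝ, A = B₀ * (2 ^ n₀ * K₀) ^ θ := ⟨_, rfl⟩
  have hBA : B₀ ≤ A := hA_def ▸ le_mul_of_one_le_right hB₀ (Real.one_le_rpow hK₀' hθ0.le)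
  have hA0 : 0 ≤ A := hB₀.trans hBA
  -- the claim, by induction over dyadic blocks above the base block `n₀`
  have claim : ∀ k : ℕ, ∀ R : ℝ, 1 ≤ R → R < 2 ^ (n₀ + k) * K₀ → D R (A * R ^ (-θ)) := by
    intro k
    induction k with
    | zero =>
      intro R hR1 hRK
      rw [add_zero] at hRK
      have hR0 : 0 < R := by linarith
      refine hmono R _ _ ?_ (hbase R hR1)
      have h1 : 1 ≤ (2 ^ n₀ * K₀) ^ θ * R ^ (-θ) := by
        rw [Real.rpow_neg hR0.le, ← div_eq_mul_inv, one_le_div (Real.rpow_pos_of_pos hR0 _)]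
        exact Real.rpow_le_rpow hR0.le hRK.le hθ0.le
      calc B₀ = B₀ * 1 := (mul_one _).symm
        _ ≤ B₀ * ((2 ^ n₀ * K₀) ^ θ * R ^ (-θ)) := mul_le_mul_of_nonneg_left h1 hB₀
        _ = A * R ^ (-θ) := by rw [hA_def, mul_assoc]
    | succ k ih =>
      intro R hR1 hRK
      set n : ℕ := n₀ + k with hn_def
      rw [show n₀ + (k + 1) = n + 1 by omega] at hRK
      by_cases hlt : R < 2 ^ n * K₀
      · exact ih R hR1 hlt
      rw [not_lt] at hlt
      have h2n : (0:ℝ) < 2 ^ n := by positivity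
      -- entrance radius `r = R / 2^{J+1} ∈ [2^n, 2^{n+1})`, `N = n`, `s₀ = 2r`
      obtain ⟨r, hr_def⟩ : ∃ r : ℝ, r = R / K₀ := ⟨_, rfl⟩
      have hRr : R = r * K₀ := by rw [hr_def, div_mul_cancel₀ R hK₀pos.ne']
      have hrlo : 2 ^ n ≤ r := by rw [hr_def, le_div_iff₀ hK₀pos]; exact hlt
      have hrhi : r < 2 ^ (n + 1) := by rw [hr_def, div_lt_iff₀ hK₀pos]; exact hRK
      have hr1 : 1 ≤ r := (one_le_pow₀ (by norm_num)).trans hrlo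
      have hr0 : 0 < r := by linarith
      have hrK : r < 2 ^ n * K₀ :=
        calc r < 2 ^ (n + 1) := hrhi
          _ = 2 ^ n * 2 := pow_succ _ _
          _ ≤ 2 ^ n * K₀ := mul_le_mul_of_nonneg_left hK₀2 h2n.le
      have hN1 : 1 ≤ r / 2 ^ n := by rwa [le_div_iff₀ h2n, one_mul]
      have hN2 : r / 2 ^ n < 2 := by
        rw [div_lt_iff₀ h2n]; rw [pow_succ] at hrhi; linarith
      have hs : r + 1 ≤ 2 * r := by linarith
      have hRJ : 2 * r * 2 ^ J = R := by rw [hRr, hK₀_def]; ring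
      have hsmin : smin ≤ 2 * r := by
        have h1 : (2:ℝ) ^ n₀ ≤ 2 ^ n := pow_le_pow_right₀ one_le_two (by omega)
        linarith
      -- the profile
      obtain ⟨η, hη⟩ : ∃ η : ℝ → ℝ, ∀ ρ, η ρ =
          if 1 ≤ ρ ∧ ρ < 2 ^ n * K₀ then A * ρ ^ (-θ) else B₀ := ⟨_, fun ρ => rfl⟩
      have hη0 : ∀ ρ, 0 ≤ η ρ := by
        intro ρ
        rw [hη]
        split_ifs with h
        · exact mul_nonneg hA0 (Real.rpow_nonneg (by linarith [h.1]) _)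
        · exact hB₀
      have hηD : ∀ ρ, 1 ≤ ρ → D ρ (η ρ) := by
        intro ρ hρ
        rw [hη]
        split_ifs with h
        · exact ih ρ hρ h.2
        · exact hbase ρ hρ
      have hηeq : ∀ ρ, 1 ≤ ρ → ρ < 2 ^ n * K₀ → η ρ = A * ρ ^ (-θ) := fun ρ hρ1 hρ2 => by
        rw [hη, if_pos ⟨hρ1, hρ2⟩]
      -- one telescoped step (at depth `2r·2^J = R`)
      have hD := hstep η hη0 hηD r (2 * r) n hN1 hN2 hs hsmin
      rw [hRJ] at hD
      refine hmono R _ _ ?_ hD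
      have h1 : R / (2 * r) = 2 ^ J := by
        rw [div_eq_iff (by positivity), hRr, hK₀_def]; ring
      have h2 : ∀ i : ℕ, R / (2 * r * 2 ^ (i + 1)) = 2 ^ J / 2 ^ (i + 1) := by
        intro i
        rw [div_eq_div_iff (by positivity) (by positivity), hRr, hK₀_def]; ring
      have h3 : ∀ i : ℕ, 2 * r * 2 ^ i / r = 2 ^ (i + 1) := by
        intro i
        rw [div_eq_iff hr0.ne']; ring
      have hstr : ∀ C : ℝ, 0 < C →
          strataSum c β B₀ r n η C ≤ c * C ^ (-β) * (A * r ^ (-θ)) * K₂ := by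
        intro C hC
        refine hstrata c B₀ A r C n η hc hB₀ hBA hr1 hN2 hC fun j hj => (hηeq _ ?_ ?_).le
        · rw [le_div_iff₀ (by positivity), one_mul]
          exact (pow_le_pow_right₀ (by norm_num) (Nat.succ_le_of_lt hj)).trans hrlo
        · exact (div_le_self hr0.le (one_le_pow₀ (by norm_num))).trans_lt hrK
      calc etaNew (fun m => cα * m ^ (-α)) c β B₀ η R r (2 * r) J n
          ≤ (cα + c * K₂ + cα * c * K₂ * J) * ((2:ℝ) ^ J) ^ (-m) * (A * r ^ (-θ)) :=
            tm_etaNew_le hcα hc hK₂ hA0 hm0 hmα hmβ hr0 h1 h2 h3 (hηeq r hr1 hrK).le hstr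
        _ ≤ ((2:ℝ) ^ (J + 1)) ^ (-θ) * (A * r ^ (-θ)) :=
            mul_le_mul_of_nonneg_right hJ (mul_nonneg hA0 (Real.rpow_nonneg hr0.le _))
        _ = A * R ^ (-θ) := by
            rw [hRr, hK₀_def, Real.mul_rpow hr0.le (by positivity : (0:ℝ) ≤ 2 ^ (J + 1))]; ring
  -- conclusion: every `R ≥ 1` lies below some `2^(n₀+k) K₀`
  refine ⟨A, θ, hθ34, fun R hR => ?_⟩
  obtain ⟨k, hk⟩ := pow_unbounded_of_one_lt R (by norm_num : (1:ℝ) < 2)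
  refine claim k R hR (hk.trans_le ?_)
  calc (2:ℝ) ^ k ≤ 2 ^ (n₀ + k) := pow_le_pow_right₀ one_le_two (by omega)
    _ ≤ 2 ^ (n₀ + k) * K₀ := le_mul_of_one_le_right (by positivity) hK₀1


end Summit.CriticalPhenomena.SAWScalingLimit.Theorems.DefectDecoherence.TipMartingale

end
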